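import Literature.MathematicalPhysics.QuantumLattice.SourcedHubbardBlockCut
import Literature.MathematicalPhysics.QuantumLattice.ApproximatingHamiltonianProofs
import HarnessLib

/-!
# Block decompositions of pair-sourced Hubbard Hamiltonians: exact separability of the partition function

Topic `MathematicalPhysics/QuantumLattice` (sequel of `SourcedHubbardBlockCut.lean`; consumer: the thermal wedge of
the Hubbard summit). For a family of order embeddings `e_j : Λ₁ ↪o Λ` (`j ∈ T`) with pairwise disjoint ranges, the
block trial Hamiltonian `K = Σ_{j ∈ T} (e_j)_* H(G₁, w₁, μ_j) + V_{rest}(U, μ_r)` (sourced Hubbard blocks at chemical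
potentials `μ_j`, atomic remainder) has an EXACTLY separable free energy:

  `log Z_β(K) = Σ_{j ∈ T} log Z_β(H(G₁, w₁, μ_j)) + #rest · log z₀(β, U, μ_r)`   (`log_partitionFn_blockSum`),

`z₀ = 1 + 2e^{βμ} + e^{β(2μ−U)}` the one-site atomic partition function — graded commutativity of the even local
algebras of disjoint regions, the product property of the normalised trace, and the volume independence
`Tr e^{(e)_* X} = 2^{|ι'|−|ι|} Tr e^{X}` of the Jordan–Wigner embedding. Everything is PROVED; no definition, no named
fact. Also recorded: the parametric (in the `DecidableEq` instances) forms of the log-partition toolkit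
(`log_partitionFn_add_of_mem'`, `log_partitionFn_sum_of_mem'`, `log_partitionFn_jwEmbed'`, `log_partitionFn_onSiteSum_region`),
the evenness of the sourced Hamiltonian and of its embeddings, the bounds `0 ≤ log z₀ ≤ 2(1 + β(U + |μ|))` for
`U ≥ 0 ≤ β`, and the operator inequality of the approximating-Hamiltonian method in state form
(`re_gibbsState_pairing_le`: `Re⟨−(g/V) ΔᴴΔ + h(Δ + Δᴴ)⟩ ≤ h²V/g` in any state given by a density matrix, from
`(Δ − (hV/g))ᴴ(Δ − (hV/g)) ≥ 0`).

References: O. Bratteli, D. W. Robinson, *Operator Algebras and QSM II* (1997), §5.2.2 (CAR algebra as a graded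
product, product trace state) [cite: BratteliRobinsonII1997, §5.2.2]; D. Ueltschi, J. Stat. Phys. 95 (1999) 693, §2.1
(factorisation property); D. Ruelle, *Statistical Mechanics* (1969), §2.3; J.-B. Bru, W. de Siqueira Pedra, Mem. AMS 224
(2013) no. 1052, Appendix (approximating Hamiltonian method, the lower bound `H(c) + |c|²V − H ≥ 0`). All [folklore].

Re-homing note: the log-partition toolkit and the evenness lemmas restate at Literature level, in instance-parametric
form, facts so far proved only inside `Summits/…/Theorems` support files of the Hubbard summit
(`…TwSeededEnsembleEquivalenceRSourcedPressureLimitFactorisation`, `…RBondSums`, `…RGibbsFactorisation`), which a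
Literature file may not import; the separability theorem and the state-form AHM inequality are new.
-/

noncomputable section

open Matrix Finset Literature.Barriers.HubbardSuperconductivity
open scoped Matrix.Norms.L2Operator ComplexOrder

namespace Literature.MathematicalPhysics.QuantumLattice

/-! ### The log-partition toolkit, parametric in the `DecidableEq` instance -/

section Toolkit

variable {ι : Type*} [LinearOrder ι] [DecidableEq ι] [Fintype ι]

/-- **Factorisation**: `log Z(A + B) + |ι| log 2 = log Z(A) + log Z(B)` for Hermitian `A` in the even CAR subalgebra of
`S₁` and Hermitian `B` in the CAR subalgebra of a disjoint `S₂`. [folklore] -/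
theorem log_partitionFn_add_of_mem' {S₁ S₂ : Finset ι} {A B : Matrix (Finset ι) (Finset ι) ℂ}
    (hA : A ∈ carEvenSubalgebra S₁) (hB : B ∈ carSubalgebra S₂) (hS : Disjoint S₁ S₂)
    (hAh : A.IsHermitian) (hBh : B.IsHermitian) (β : ℝ) :
    Real.log (partitionFn β (A + B)).re + Fintype.card ι * Real.log 2 =
      Real.log (partitionFn β A).re + Real.log (partitionFn β B).re := by
  obtain rfl : ‹DecidableEq ι› = LinearOrder.toDecidableEq := Subsingleton.elim _ _
  have hA' : -(β : ℂ) • A ∈ carEvenSubalgebra S₁ := Subalgebra.smul_mem _ hA _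
  have hB' : -(β : ℂ) • B ∈ carSubalgebra S₂ := Subalgebra.smul_mem _ hB _
  have hc : Commute (-(β : ℂ) • A) (-(β : ℂ) • B) := commute_of_mem_carEvenSubalgebra hA' hB' hS
  have h : partitionFn β (A + B) * 2 ^ Fintype.card ι = partitionFn β A * partitionFn β B := by
    simp only [partitionFn, gibbsWeight]
    rw [smul_add, Matrix.exp_add_of_commute _ _ hc]
    exact trace_mul_of_mem_carSubalgebra (exp_mem_subalgebra _ (carEvenSubalgebra_le_carSubalgebra _ hA'))
      (exp_mem_subalgebra _ hB') hS
  have hABh : (A + B).IsHermitian := hAh.add hBh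
  rw [partitionFn_eq_re hABh, partitionFn_eq_re hAh, partitionFn_eq_re hBh] at h
  have h' : (partitionFn β (A + B)).re * 2 ^ Fintype.card ι = (partitionFn β A).re * (partitionFn β B).re := by
    exact_mod_cast h
  have hpA := partitionFn_re_pos hAh β
  have hpB := partitionFn_re_pos hBh β
  have hpAB := partitionFn_re_pos hABh β
  have h2 : (0 : ℝ) < 2 ^ Fintype.card ι := by positivity
  have := congrArg Real.log h'
  rw [Real.log_mul hpAB.ne' h2.ne', Real.log_mul hpA.ne' hpB.ne', Real.log_pow] at this
  linarith

/-- A sum of elements of the even CAR subalgebras of the `S j` lies in the CAR subalgebra of their union. [folklore] -/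
theorem sum_mem_carSubalgebra_biUnion' {J : Type*} (T : Finset J) (S : J → Finset ι)
    (X : J → Matrix (Finset ι) (Finset ι) ℂ) (hX : ∀ j ∈ T, X j ∈ carEvenSubalgebra (S j)) :
    ∑ j ∈ T, X j ∈ carSubalgebra (T.biUnion S) := by
  obtain rfl : ‹DecidableEq ι› = LinearOrder.toDecidableEq := Subsingleton.elim _ _
  exact Subalgebra.sum_mem _ fun j hj =>
    carSubalgebra_mono (Finset.subset_biUnion_of_mem S hj) (carEvenSubalgebra_le_carSubalgebra _ (hX j hj))

/-- **Factorisation over finitely many disjoint regions**: for Hermitian `X_j` in the even CAR subalgebras of pairwise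
disjoint orbital sets `S_j`, `log Z(Σ_{j ∈ T} X_j) + #T·|ι| log 2 = Σ_{j ∈ T} log Z(X_j) + |ι| log 2`. [folklore] -/
theorem log_partitionFn_sum_of_mem' {J : Type*} [DecidableEq J] (T : Finset J) (S : J → Finset ι)
    (X : J → Matrix (Finset ι) (Finset ι) ℂ) (hX : ∀ j ∈ T, X j ∈ carEvenSubalgebra (S j))
    (hXh : ∀ j ∈ T, (X j).IsHermitian) (hS : ∀ j ∈ T, ∀ j' ∈ T, j ≠ j' → Disjoint (S j) (S j')) (β : ℝ) :
    Real.log (partitionFn β (∑ j ∈ T, X j)).re + T.card * (Fintype.card ι * Real.log 2) =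
      ∑ j ∈ T, Real.log (partitionFn β (X j)).re + Fintype.card ι * Real.log 2 := by
  induction T using Finset.induction_on with
  | empty =>
    have h0 : Real.log (partitionFn β (0 : Matrix (Finset ι) (Finset ι) ℂ)).re = Fintype.card ι * Real.log 2 := by
      rw [partitionFn, gibbsWeight, smul_zero, NormedSpace.exp_zero, trace_one, Fintype.card_finset]
      push_cast
      rw [← Complex.ofReal_ofNat, ← Complex.ofReal_pow, Complex.ofReal_re, Real.log_pow]
    simp [h0]
  | @insert a T haT ih =>
    have hXT : ∀ j ∈ T, X j ∈ carEvenSubalgebra (S j) := fun j hj => hX j (Finset.mem_insert_of_mem hj)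
    have hXhT : ∀ j ∈ T, (X j).IsHermitian := fun j hj => hXh j (Finset.mem_insert_of_mem hj)
    have hST : ∀ j ∈ T, ∀ j' ∈ T, j ≠ j' → Disjoint (S j) (S j') := fun j hj j' hj' =>
      hS j (Finset.mem_insert_of_mem hj) j' (Finset.mem_insert_of_mem hj')
    have ih' := ih hXT hXhT hST
    have hdisj : Disjoint (S a) (T.biUnion S) := by
      rw [Finset.disjoint_biUnion_right]
      intro j hj
      exact hS a (Finset.mem_insert_self a T) j (Finset.mem_insert_of_mem hj) (fun h => haT (h ▸ hj))
    have hsumh : (∑ j ∈ T, X j).IsHermitian := by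
      rw [Matrix.IsHermitian, Matrix.conjTranspose_sum]
      exact Finset.sum_congr rfl fun i hi => (hXhT i hi).eq
    have h2 := log_partitionFn_add_of_mem' (hX a (Finset.mem_insert_self a T))
      (sum_mem_carSubalgebra_biUnion' T S X hXT) hdisj (hXh a (Finset.mem_insert_self a T)) hsumh β
    rw [Finset.sum_insert haT, Finset.sum_insert haT, Finset.card_insert_of_notMem haT]
    push_cast
    linarith

/-- **Volume independence of the normalised partition function**: along an order embedding of orbital sets,
`log Z(jwEmbed e H) = log Z(H) + (|ι'| − |ι|) log 2` for Hermitian `H`. [folklore] -/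
theorem log_partitionFn_jwEmbed' {ι' : Type*} [LinearOrder ι'] [DecidableEq ι'] [Fintype ι'] (e : ι ↪o ι')
    {H : Matrix (Finset ι) (Finset ι) ℂ} (hH : H.IsHermitian) (β : ℝ) :
    Real.log (partitionFn β (jwEmbed e H)).re =
      Real.log (partitionFn β H).re + ((Fintype.card ι' : ℝ) - Fintype.card ι) * Real.log 2 := by
  obtain rfl : ‹DecidableEq ι› = LinearOrder.toDecidableEq := Subsingleton.elim _ _
  obtain rfl : ‹DecidableEq ι'› = LinearOrder.toDecidableEq := Subsingleton.elim _ _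
  have hle : Fintype.card ι ≤ Fintype.card ι' := Fintype.card_le_of_embedding e.toEmbedding
  have h1 : partitionFn β (jwEmbed e H) = 2 ^ (Fintype.card ι' - Fintype.card ι) * partitionFn β H := by
    simp only [partitionFn, gibbsWeight]
    rw [← map_smul, trace_exp_jwEmbed]
  have h2 : (partitionFn β (jwEmbed e H)).re = (2 : ℝ) ^ (Fintype.card ι' - Fintype.card ι) * (partitionFn β H).re := by
    rw [h1, partitionFn_eq_re hH]
    norm_cast
  have hp := partitionFn_re_pos hH β
  rw [h2, Real.log_mul (by positivity) hp.ne', Real.log_pow, Nat.cast_sub hle]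
  ring

end Toolkit

/-! ### Evenness of the sourced Hamiltonian and of its embeddings -/

section Even

variable {Λ : Type*} [LinearOrder Λ] [Fintype Λ]

/-- The singlet bond pair `b_{xy}` is an even local operator of `{x, y}`. [folklore] -/
theorem bondPair_mem_carEvenSubalgebra {A : Finset Λ} {x y : Λ} (hx : x ∈ A) (hy : y ∈ A) :
    bondPair x y ∈ carEvenSubalgebra (orbs A) := by
  unfold bondPair
  exact Subalgebra.sub_mem _
    (Algebra.subset_adjoin ⟨(orb x 0, false), (orb y 1, false), orb_mem_orbs.2 hx, orb_mem_orbs.2 hy, rfl⟩)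
    (Algebra.subset_adjoin ⟨(orb x 1, false), (orb y 0, false), orb_mem_orbs.2 hx, orb_mem_orbs.2 hy, rfl⟩)

/-- `b_{xy}ᴴ` is an even local operator of `{x, y}`. [folklore] -/
theorem bondPair_conjTranspose_mem_carEvenSubalgebra {A : Finset Λ} {x y : Λ} (hx : x ∈ A) (hy : y ∈ A) :
    (bondPair x y)ᴴ ∈ carEvenSubalgebra (orbs A) := by
  rw [bondPair_conjTranspose]
  exact Subalgebra.sub_mem _
    (Algebra.subset_adjoin ⟨(orb y 1, true), (orb x 0, true), orb_mem_orbs.2 hy, orb_mem_orbs.2 hx, rfl⟩)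
    (Algebra.subset_adjoin ⟨(orb y 0, true), (orb x 1, true), orb_mem_orbs.2 hy, orb_mem_orbs.2 hx, rfl⟩)

/-- `P_w` is an even local operator of `A` if `w` is supported on `A × A`. [folklore] -/
theorem pairSum_mem_carEvenSubalgebra {A : Finset Λ} {w : Λ × Λ → ℂ} (hw : ∀ z, w z ≠ 0 → z.1 ∈ A ∧ z.2 ∈ A) :
    (∑ z : Λ × Λ, w z • bondPair z.1 z.2) ∈ carEvenSubalgebra (orbs A) := by
  refine Subalgebra.sum_mem _ fun z _ => ?_
  by_cases hz : w z = 0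
  · rw [hz, zero_smul]; exact Subalgebra.zero_mem _
  · exact Subalgebra.smul_mem _ (bondPair_mem_carEvenSubalgebra (hw z hz).1 (hw z hz).2) _

/-- `P_wᴴ` is an even local operator of `A` if `w` is supported on `A × A`. [folklore] -/
theorem pairSum_conjTranspose_mem_carEvenSubalgebra {A : Finset Λ} {w : Λ × Λ → ℂ}
    (hw : ∀ z, w z ≠ 0 → z.1 ∈ A ∧ z.2 ∈ A) :
    (∑ z : Λ × Λ, w z • bondPair z.1 z.2)ᴴ ∈ carEvenSubalgebra (orbs A) := by
  rw [conjTranspose_sum]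
  refine Subalgebra.sum_mem _ fun z _ => ?_
  rw [conjTranspose_smul]
  by_cases hz : w z = 0
  · rw [hz, star_zero, zero_smul]; exact Subalgebra.zero_mem _
  · exact Subalgebra.smul_mem _ (bondPair_conjTranspose_mem_carEvenSubalgebra (hw z hz).1 (hw z hz).2) _

/-- **The sourced Hamiltonian is an even element of the CAR algebra of all sites.** [folklore] -/
theorem sourced_mem_carEvenSubalgebra (G : SimpleGraph Λ) [DecidableRel G.Adj] (t U μ h : ℝ) (w : Λ × Λ → ℂ) :
    (hamiltonianWith G t U μ - (h : ℂ) • ((∑ z : Λ × Λ, w z • bondPair z.1 z.2) + (∑ z : Λ × Λ, w z • bondPair z.1 z.2)ᴴ)) ∈ carEvenSubalgebra (orbs (Finset.univ : Finset Λ)) := by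
  rw [hamiltonianWith_eq_onSiteSum_sub_hopSum]
  refine Subalgebra.sub_mem _ (Subalgebra.sub_mem _ (onSiteSum_mem _ _ subset_rfl)
    (hopSum_mem fun b _ => ⟨Finset.mem_univ _, Finset.mem_univ _⟩)) (Subalgebra.smul_mem _ (Subalgebra.add_mem _
      (pairSum_mem_carEvenSubalgebra fun z _ => ⟨Finset.mem_univ _, Finset.mem_univ _⟩)
      (pairSum_conjTranspose_mem_carEvenSubalgebra fun z _ => ⟨Finset.mem_univ _, Finset.mem_univ _⟩)) _)

/-- **Isotony of the even subalgebras under second quantisation**: `jwEmbed (orbEmb e)` maps the even CAR subalgebra of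
the orbital set `S` into the even CAR subalgebra of its image. [folklore] -/
theorem jwEmbed_mem_carEvenSubalgebra_of_mem {Λ' : Type*} [LinearOrder Λ'] [Fintype Λ'] (e : Λ ↪o Λ')
    {S : Finset (Orb Λ)} {T : Finset (Orb Λ')} (hST : ∀ i ∈ S, orbEmb e i ∈ T) {P : Matrix (Finset (Orb Λ)) (Finset (Orb Λ)) ℂ}
    (hP : P ∈ carEvenSubalgebra S) : jwEmbed (orbEmb e) P ∈ carEvenSubalgebra T := by
  have hle : Subalgebra.map (jwEmbed (orbEmb e)) (carEvenSubalgebra S) ≤ carEvenSubalgebra T := by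
    rw [carEvenSubalgebra, AlgHom.map_adjoin]
    refine Algebra.adjoin_le ?_
    rintro _ ⟨M, ⟨l, l', hl, hl', rfl⟩, rfl⟩
    refine Algebra.subset_adjoin ⟨(orbEmb e l.1, l.2), (orbEmb e l'.1, l'.2), hST _ hl, hST _ hl', ?_⟩
    rw [map_mul]
    congr 1
    · rcases l with ⟨i, b⟩
      cases b <;> simp [letterOp]
    · rcases l' with ⟨i, b⟩
      cases b <;> simp [letterOp]
  exact hle ⟨P, hP, rfl⟩

/-- **An embedded sourced block is an even element of the CAR algebra of its range.** [folklore] -/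
theorem jwEmbed_sourced_mem_carEvenSubalgebra {Λ₁ : Type*} [LinearOrder Λ₁] [Fintype Λ₁] (e : Λ₁ ↪o Λ)
    (G₁ : SimpleGraph Λ₁) [DecidableRel G₁.Adj] (t U μ h : ℝ) (w₁ : Λ₁ × Λ₁ → ℂ) :
    jwEmbed (orbEmb e) (hamiltonianWith G₁ t U μ - (h : ℂ) • ((∑ z : Λ₁ × Λ₁, w₁ z • bondPair z.1 z.2) + (∑ z : Λ₁ × Λ₁, w₁ z • bondPair z.1 z.2)ᴴ)) ∈ carEvenSubalgebra (orbs ((Finset.univ : Finset Λ₁).map (e).toEmbedding)) := by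
  refine jwEmbed_mem_carEvenSubalgebra_of_mem e (fun i _ => ?_) (sourced_mem_carEvenSubalgebra G₁ t U μ h w₁)
  have : orbEmb e i = orb (e (ofLex i).1) (ofLex i).2 := rfl
  rw [this]
  exact orb_mem_orbs.2 (Finset.mem_map.2 ⟨(ofLex i).1, Finset.mem_univ _, rfl⟩)

end Even

/-! ### The atomic remainder and the separability of the block partition function -/

section Separability

variable {Λ Λ₁ : Type*} [LinearOrder Λ] [DecidableEq Λ] [Fintype Λ] [LinearOrder Λ₁] [DecidableEq Λ₁] [Fintype Λ₁]
  {J : Type*}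

omit [DecidableEq Λ₁] [LinearOrder Λ₁] [Fintype Λ₁] in
/-- **Atomic remainder**: `log Z_β(V_R(U, μ)) = #R · log z₀(β, U, μ) + (|Λ| − #R) · 2 log 2` on the Fock space of `Λ`.
[folklore] -/
theorem log_partitionFn_onSiteSum_region (β U μ : ℝ) (R : Finset Λ) :
    Real.log (partitionFn β (onSiteSum (U : ℂ) (μ : ℂ) R)).re =
      R.card * Real.log (atomicPartitionFnReal β U μ) + ((Fintype.card Λ - R.card : ℕ) : ℝ) * (2 * Real.log 2) := by
  obtain rfl : ‹DecidableEq Λ› = LinearOrder.toDecidableEq := Subsingleton.elim _ _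
  have h1 : partitionFn β (onSiteSum (U : ℂ) (μ : ℂ) R) =
      (((atomicPartitionFnReal β U μ ^ R.card * 4 ^ (Fintype.card Λ - R.card) : ℝ)) : ℂ) := by
    rw [partitionFn, gibbsWeight, neg_smul, trace_exp_neg_onSiteSum, atomicPartitionFn_ofReal]
    push_cast
    ring
  have hz := atomicPartitionFnReal_pos β U μ
  rw [h1, Complex.ofReal_re, Real.log_mul (pow_pos hz _).ne' (pow_pos (by norm_num) _).ne', Real.log_pow, Real.log_pow,
    show (4 : ℝ) = 2 ^ 2 by norm_num, Real.log_pow]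
  push_cast
  ring

omit [DecidableEq Λ₁] [LinearOrder Λ₁] [Fintype Λ₁] [LinearOrder Λ] [DecidableEq Λ] [Fintype Λ] in
/-- **The one-site atomic free energy is bounded**: `0 ≤ log z₀(β, U, μ) ≤ 2(1 + β(U + |μ|))` for `U ≥ 0`, `β ≥ 0`
(`1 ≤ z₀ ≤ 4e^{2β|μ|}`). [folklore] -/
theorem log_atomicPartitionFnReal_bounds {β U : ℝ} (hβ : 0 ≤ β) (hU : 0 ≤ U) (μ : ℝ) :
    0 ≤ Real.log (atomicPartitionFnReal β U μ) ∧ Real.log (atomicPartitionFnReal β U μ) ≤ 2 * (1 + β * (U + |μ|)) := by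
  have h1 : 1 ≤ atomicPartitionFnReal β U μ := by
    unfold atomicPartitionFnReal
    have := Real.exp_pos (β * μ); have := Real.exp_pos (-(β * (U - 2 * μ))); linarith
  refine ⟨Real.log_nonneg h1, ?_⟩
  have hμ : β * μ ≤ β * |μ| := mul_le_mul_of_nonneg_left (le_abs_self μ) hβ
  have e1 : Real.exp (β * μ) ≤ Real.exp (2 * (β * |μ|)) := Real.exp_le_exp.2 (by nlinarith [abs_nonneg μ])
  have e2 : Real.exp (-(β * (U - 2 * μ))) ≤ Real.exp (2 * (β * |μ|)) :=
    Real.exp_le_exp.2 (by nlinarith [abs_nonneg μ, mul_nonneg hβ hU])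
  have h4 : atomicPartitionFnReal β U μ ≤ 4 * Real.exp (2 * (β * |μ|)) := by
    unfold atomicPartitionFnReal
    have := Real.add_one_le_exp (2 * (β * |μ|))
    nlinarith [abs_nonneg μ, mul_nonneg hβ (abs_nonneg μ)]
  have hlog := Real.log_le_log (by linarith) h4
  rw [Real.log_mul (by norm_num) (Real.exp_pos _).ne', Real.log_exp] at hlog
  have hl4 : Real.log 4 ≤ 2 := by
    have := Real.log_two_lt_d9
    rw [show (4 : ℝ) = 2 ^ 2 by norm_num, Real.log_pow]
    norm_num
    linarith
  nlinarith [mul_nonneg hβ hU]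

omit [DecidableEq Λ₁] in
/-- **Exact separability of the block partition function**: for pairwise disjoint ranges,
`log Z_β(Σ_{j ∈ T} (e_j)_* H(G₁,w₁,μ_j) + V_{rest}(U, μ_r)) = Σ_{j ∈ T} log Z_β(H(G₁,w₁,μ_j)) + #rest · log z₀(β,U,μ_r)`,
`rest = (⋃_j e_j Λ₁)ᶜ`. [folklore] -/
theorem log_partitionFn_blockSum [DecidableEq Λ₁] [DecidableEq J] (T : Finset J) (e : J → Λ₁ ↪o Λ)
    (hdisj : ∀ j ∈ T, ∀ j' ∈ T, j ≠ j' → ∀ x y, e j x ≠ e j' y)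
    (G₁ : SimpleGraph Λ₁) [DecidableRel G₁.Adj] (t U h : ℝ) (w₁ : Λ₁ × Λ₁ → ℂ) (μ : J → ℝ) (μr β : ℝ) :
    Real.log (partitionFn β ((∑ j ∈ T, jwEmbed (orbEmb (e j)) (hamiltonianWith G₁ t U (μ j) - (h : ℂ) • ((∑ z : Λ₁ × Λ₁, w₁ z • bondPair z.1 z.2) + (∑ z : Λ₁ × Λ₁, w₁ z • bondPair z.1 z.2)ᴴ))) +
        onSiteSum (U : ℂ) (μr : ℂ) (T.biUnion fun j => ((Finset.univ : Finset Λ₁).map (e j).toEmbedding))ᶜ)).re =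
      ∑ j ∈ T, Real.log (partitionFn β (hamiltonianWith G₁ t U (μ j) - (h : ℂ) • ((∑ z : Λ₁ × Λ₁, w₁ z • bondPair z.1 z.2) + (∑ z : Λ₁ × Λ₁, w₁ z • bondPair z.1 z.2)ᴴ))).re +
        (((T.biUnion fun j => ((Finset.univ : Finset Λ₁).map (e j).toEmbedding))ᶜ).card : ℝ) * Real.log (atomicPartitionFnReal β U μr) := by
  set RR := (T.biUnion fun j => ((Finset.univ : Finset Λ₁).map (e j).toEmbedding))ᶜ with hRR
  set X : J → Matrix (Finset (Orb Λ)) (Finset (Orb Λ)) ℂ := fun j => jwEmbed (orbEmb (e j)) (hamiltonianWith G₁ t U (μ j) - (h : ℂ) • ((∑ z : Λ₁ × Λ₁, w₁ z • bondPair z.1 z.2) + (∑ z : Λ₁ × Λ₁, w₁ z • bondPair z.1 z.2)ᴴ)) with hX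
  -- locality and Hermiticity of the summands
  have hXmem : ∀ j ∈ T, X j ∈ carEvenSubalgebra (orbs ((Finset.univ : Finset Λ₁).map (e j).toEmbedding)) := fun j _ =>
    jwEmbed_sourced_mem_carEvenSubalgebra (e j) G₁ t U (μ j) h w₁
  have hXh : ∀ j ∈ T, (X j).IsHermitian := fun j _ =>
    isHermitian_jwEmbed_of_isHermitian (e j) (isHermitian_sourced G₁ t U (μ j) h w₁)
  have hSdisj : ∀ j ∈ T, ∀ j' ∈ T, j ≠ j' → Disjoint (orbs ((Finset.univ : Finset Λ₁).map (e j).toEmbedding)) (orbs ((Finset.univ : Finset Λ₁).map (e j').toEmbedding)) := fun j hj j' hj' hne =>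
    disjoint_orbs (disjoint_map_of_ne_range T e hdisj (fun _ => Finset.univ) j hj j' hj' hne)
  have hA : onSiteSum (U : ℂ) (μr : ℂ) RR ∈ carEvenSubalgebra (orbs RR) := onSiteSum_mem _ _ subset_rfl
  have hAh : (onSiteSum (U : ℂ) (μr : ℂ) RR).IsHermitian := isHermitian_onSiteSum_ofReal U μr RR
  have hB : ∑ j ∈ T, X j ∈ carSubalgebra (T.biUnion fun j => orbs ((Finset.univ : Finset Λ₁).map (e j).toEmbedding)) :=
    sum_mem_carSubalgebra_biUnion' T _ X hXmem
  have hBh : (∑ j ∈ T, X j).IsHermitian := by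
    rw [Matrix.IsHermitian, Matrix.conjTranspose_sum]
    exact Finset.sum_congr rfl fun j hj => (hXh j hj).eq
  have hAB : Disjoint (orbs RR) (T.biUnion fun j => orbs ((Finset.univ : Finset Λ₁).map (e j).toEmbedding)) := by
    rw [← orbs_biUnion, hRR, orbs_compl]
    exact disjoint_compl_left
  -- the three exact identities
  have e1 := log_partitionFn_add_of_mem' hA hB hAB hAh hBh β
  have e2 := log_partitionFn_sum_of_mem' T (fun j => orbs ((Finset.univ : Finset Λ₁).map (e j).toEmbedding)) X hXmem hXh hSdisj β
  have e3 : ∀ j ∈ T, Real.log (partitionFn β (X j)).re = Real.log (partitionFn β (hamiltonianWith G₁ t U (μ j) - (h : ℂ) • ((∑ z : Λ₁ × Λ₁, w₁ z • bondPair z.1 z.2) + (∑ z : Λ₁ × Λ₁, w₁ z • bondPair z.1 z.2)ᴴ))).re +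
      ((Fintype.card (Orb Λ) : ℝ) - Fintype.card (Orb Λ₁)) * Real.log 2 := fun j _ =>
    log_partitionFn_jwEmbed' (orbEmb (e j)) (isHermitian_sourced G₁ t U (μ j) h w₁) β
  have e4 := log_partitionFn_onSiteSum_region β U μr RR
  -- cardinalities: `|Orb Λ| = 2|Λ|`, `#rest = |Λ| - #T·|Λ₁|`
  have cOΛ : (Fintype.card (Orb Λ) : ℝ) = 2 * Fintype.card Λ := by
    rw [show Fintype.card (Orb Λ) = 2 * Fintype.card Λ by simp [Orb, Lex, Fintype.card_prod, mul_comm]]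
    push_cast; ring
  have cOΛ₁ : (Fintype.card (Orb Λ₁) : ℝ) = 2 * Fintype.card Λ₁ := by
    rw [show Fintype.card (Orb Λ₁) = 2 * Fintype.card Λ₁ by simp [Orb, Lex, Fintype.card_prod, mul_comm]]
    push_cast; ring
  have cU : (T.biUnion fun j => ((Finset.univ : Finset Λ₁).map (e j).toEmbedding)).card = T.card * Fintype.card Λ₁ := by
    rw [Finset.card_biUnion (fun j hj j' hj' hne => disjoint_map_of_ne_range T e hdisj (fun _ => Finset.univ) j hj j' hj' hne)]
    simp [Finset.sum_const, Finset.card_univ]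
  have cle : T.card * Fintype.card Λ₁ ≤ Fintype.card Λ := by
    rw [← cU]; exact Finset.card_le_univ _
  have cR' : ((Fintype.card Λ - RR.card : ℕ) : ℝ) = T.card * Fintype.card Λ₁ := by
    rw [hRR, Finset.card_compl, cU, Nat.sub_sub_self cle]; push_cast; ring
  have hsum : ∑ j ∈ T, Real.log (partitionFn β (X j)).re =
      ∑ j ∈ T, Real.log (partitionFn β (hamiltonianWith G₁ t U (μ j) - (h : ℂ) • ((∑ z : Λ₁ × Λ₁, w₁ z • bondPair z.1 z.2) + (∑ z : Λ₁ × Λ₁, w₁ z • bondPair z.1 z.2)ᴴ))).re +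
        T.card * (((Fintype.card (Orb Λ) : ℝ) - Fintype.card (Orb Λ₁)) * Real.log 2) := by
    rw [Finset.sum_congr rfl e3, Finset.sum_add_distrib, Finset.sum_const, nsmul_eq_mul]
  rw [add_comm (onSiteSum (U : ℂ) (μr : ℂ) RR)] at e1
  rw [cOΛ] at e1 e2
  rw [cOΛ, cOΛ₁] at hsum
  rw [cR'] at e4
  linarith

end Separability

/-! ### The operator inequality of the approximating-Hamiltonian method, in state form -/

section AHM

variable {n : Type*} [Fintype n] [DecidableEq n]

/-- **`−(g/V) ΔᴴΔ + h(Δ + Δᴴ) ≤ (h²V/g)·1` in every Gibbs state**: for `g, V > 0` and a Hermitian `H`,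
`Re ⟨−(g/V) ΔᴴΔ + h(Δ + Δᴴ)⟩_{β,H} ≤ h²V/g`, since `(g/V)(Δ − (hV/g))ᴴ(Δ − (hV/g)) ≥ 0` expands to
`(g/V)ΔᴴΔ − h(Δ+Δᴴ) + (h²V/g)·1`. [folklore] -/
theorem re_gibbsState_pairing_le {H : Matrix n n ℂ} (hH : H.IsHermitian) [Nonempty n] (β : ℝ) (Δ : Matrix n n ℂ)
    {g V : ℝ} (hg : 0 < g) (hV : 0 < V) (h : ℝ) :
    (gibbsState β H (-(((g / V : ℝ) : ℂ) • (Δᴴ * Δ)) + (h : ℂ) • (Δ + Δᴴ))).re ≤ h ^ 2 / g * V := by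
  set c : ℝ := h * V / g with hc
  have hpsd : (((g / V : ℝ) : ℂ) • ((Δ - (c : ℂ) • 1)ᴴ * (Δ - (c : ℂ) • 1))).PosSemidef :=
    (posSemidef_conjTranspose_mul_self _).smul (by exact_mod_cast (div_pos hg hV).le)
  have hexp : ((g / V : ℝ) : ℂ) • ((Δ - (c : ℂ) • 1)ᴴ * (Δ - (c : ℂ) • 1)) =
      ((h ^ 2 / g * V : ℝ) : ℂ) • (1 : Matrix n n ℂ) - (-(((g / V : ℝ) : ℂ) • (Δᴴ * Δ)) + (h : ℂ) • (Δ + Δᴴ)) := by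
    have e1 : ((g / V : ℝ) : ℂ) * (c : ℂ) = (h : ℂ) := by
      rw [hc]; push_cast; field_simp
    have e2 : ((g / V : ℝ) : ℂ) * ((c : ℂ) * (c : ℂ)) = ((h ^ 2 / g * V : ℝ) : ℂ) := by
      rw [hc]; push_cast; field_simp
    rw [conjTranspose_sub, conjTranspose_smul, conjTranspose_one, Complex.star_def, Complex.conj_ofReal]
    simp only [Matrix.sub_mul, Matrix.mul_sub, Matrix.smul_mul, Matrix.mul_smul, Matrix.one_mul, Matrix.mul_one]
    rw [← e1, ← e2]
    module
  have hZ : partitionFn β H ≠ 0 := (Matrix.partitionFn_pos β hH).ne'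
  have h0 := gibbsState_nonneg_of_posSemidef β hH hpsd
  rw [hexp, map_sub, map_smul, gibbsState_one β H hZ, smul_eq_mul, mul_one] at h0
  obtain ⟨hre, -⟩ := Complex.nonneg_iff.mp h0
  rw [Complex.sub_re, Complex.ofReal_re] at hre
  linarith

/-- **States are bounded by the operator norm, real part**: `Re⟨X⟩ ≤ ‖X‖`. [folklore] -/
theorem re_gibbsState_le_norm {H : Matrix n n ℂ} (hH : H.IsHermitian) [Nonempty n] (β : ℝ) (X : Matrix n n ℂ) :
    (gibbsState β H X).re ≤ ‖X‖ :=
  (le_abs_self _).trans (abs_re_gibbsState_le hH β X)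

/-- Expectations of real multiples: `Re⟨(a : ℂ) • X⟩ = a · Re⟨X⟩`. [folklore] -/
theorem re_gibbsState_real_smul (β : ℝ) (H X : Matrix n n ℂ) (a : ℝ) :
    (gibbsState β H ((a : ℂ) • X)).re = a * (gibbsState β H X).re := by
  rw [map_smul, smul_eq_mul, Complex.re_ofReal_mul]

end AHM

end Literature.MathematicalPhysics.QuantumLattice
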